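import Literature.GroupTheory.CombinatorialGroupTheory.NielsenGeneratingTuples
import HarnessLib

/-!
# Two non-commuting elements of a free group freely generate a free group of rank two

Topic `Literature/GroupTheory/CombinatorialGroupTheory`; theorems only.

* `IsNielsenReduced.lift_injective` — a Nielsen-reduced family is a free basis of the subgroup it
  generates: the evaluation homomorphism `FreeGroup ι → F` is injective (Lyndon–Schupp, Ch. I,
  Prop. 2.5: *"if `U` is N-reduced, then `Gp(U)` is free with `U` as basis"*, from the length
  inequality Cor. 2.4, `IsNielsenReduced.length_le_norm`).
* `isNielsenReduced_of_min_of_forall_ne_one` — a tuple of minimal Nielsen measure without trivial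
  entries is Nielsen reduced (Prop. 2.2).
* `lift_injective_of_mul_ne` — **if `x, y` do not commute then `{x, y}` is a free basis of
  `⟨x, y⟩`**: the homomorphism `F(x₀, x₁) → F`, `x₀ ↦ x`, `x₁ ↦ y` is injective (Lyndon–Schupp,
  Ch. I, Prop. 2.17 for `n = 2` with Prop. 2.7/2.8: a two-generator subgroup of a free group is free
  of rank `≤ 2`, and of rank `2` with the given generators as basis unless it is cyclic).  Proof:
  Nielsen-reduce the pair (`exists_forall_not_lt`); a trivial entry of the reduced pair would make
  `⟨x, y⟩` cyclic, so both entries survive, the reduced pair is a basis, and Nielsen transformations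
  are automorphisms of `F(x₀, x₁)`.
* `FreeGroup.lift_bool_injective_of_mul_ne` — the same over the index type `Bool` and inside
  `F₂ = FreeGroup Bool` (the form used for surface groups in `Literature/IUT/HodgeTheaters`).

## References

* R. C. Lyndon, P. E. Schupp, *Combinatorial Group Theory*, Springer (1977); Classics in
  Mathematics (2001), Ch. I §2, Prop. 2.2, Cor. 2.4, Prop. 2.5, Prop. 2.7, Prop. 2.17.
  [LyndonSchupp2001]
* W. Magnus, A. Karrass, D. Solitar, *Combinatorial Group Theory*, Interscience (1966); Dover
  (1976), §3.2, Thm. 3.3 and Cor. 3.3 (N-reduced sets freely generate). [MagnusKarrassSolitar1966]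
-/

namespace Literature.GroupTheory.CombinatorialGroupTheory

open List

section Reduced

variable {ι α : Type*} [DecidableEq ι] [DecidableEq α] {U : ι → FreeGroup α}

/-- **A Nielsen-reduced family is a free basis of the subgroup it generates**: the evaluation
homomorphism `F(ι) → F`, `xᵢ ↦ Uᵢ`, is injective (a non-trivial reduced word has a non-trivial
image by the length inequality). [cite: LyndonSchupp2001, Ch. I Prop. 2.5] -/
theorem IsNielsenReduced.lift_injective (h : IsNielsenReduced U) :
    Function.Injective (FreeGroup.lift U) := by
  rw [injective_iff_map_eq_one]
  intro x hx
  have hle := h.length_le_norm x.toWord FreeGroup.isReduced_toWord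
  rw [FreeGroup.mk_toWord, hx, FreeGroup.norm_one, Nat.le_zero, List.length_eq_zero_iff] at hle
  exact FreeGroup.toWord_eq_nil_iff.1 hle

end Reduced

section Fin

variable {n k : ℕ}

/-- **A tuple of minimal Nielsen measure without trivial entries is Nielsen reduced**
(Lyndon–Schupp, Ch. I, Prop. 2.2; `isNielsenReduced_of_min` for the subfamily of non-trivial
entries, which here is everything). [cite: LyndonSchupp2001, Ch. I Prop. 2.2] -/
theorem isNielsenReduced_of_min_of_forall_ne_one (u : Fin n → FreeGroup (Fin k))
    (hu : ∀ ε : MulAut (FreeGroup (Fin n)),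
      ¬ toLex (∑ i, ((⇑(FreeGroup.lift u) ∘ basisImage ε) i).norm,
            ∑ i, lexWeight ((⇑(FreeGroup.lift u) ∘ basisImage ε) i)) <
          toLex (∑ i, (u i).norm, ∑ i, lexWeight (u i)))
    (h1 : ∀ i, u i ≠ 1) : IsNielsenReduced u := by
  have h := isNielsenReduced_of_min u hu
  have hc : ∀ a b : Fin n × Bool, ¬ Cancels a b →
      ¬ Cancels ((⟨a.1, h1 a.1⟩ : {i : Fin n // u i ≠ 1}), a.2) (⟨b.1, h1 b.1⟩, b.2) :=
    fun a b hab h' => hab ⟨congrArg Subtype.val h'.1, h'.2⟩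
  refine ⟨h1, fun a b hab => ?_, fun a b c hab hbc => ?_⟩
  · simpa only [val_subtype] using h.two_mul_maxCancel_le _ _ (hc a b hab)
  · simpa only [val_subtype] using h.not_halves _ _ _ (hc a b hab) (hc b c hbc)

/-- If one entry of a Nielsen transform of the pair `(u₀, u₁)` is trivial then `u₀` and `u₁`
commute (both lie in the cyclic group generated by the other entry). [folklore] -/
private theorem mul_eq_mul_of_transform_eq_one (u : Fin 2 → FreeGroup (Fin k))
    (ε : MulAut (FreeGroup (Fin 2))) (i j : Fin 2) (hij : i ≠ j)
    (hi : (⇑(FreeGroup.lift u) ∘ basisImage ε) i = 1) : u 0 * u 1 = u 1 * u 0 := by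
  have hsub : Subgroup.closure (Set.range u) ≤
      Subgroup.zpowers ((⇑(FreeGroup.lift u) ∘ basisImage ε) j) := by
    rw [← closure_range_lift_comp_basisImage u ε, Subgroup.closure_le]
    rintro _ ⟨l, rfl⟩
    rcases eq_or_ne l i with rfl | hl
    · rw [show (⇑(FreeGroup.lift u) ∘ basisImage ε) l = 1 from hi]
      exact one_mem _
    · have hlj : l = j := by
        have key : ∀ i j l : Fin 2, i ≠ j → l ≠ i → l = j := by decide
        exact key i j l hij hl
      subst hlj
      exact Subgroup.mem_zpowers _
  obtain ⟨a, ha⟩ := Subgroup.mem_zpowers_iff.1 (hsub (Subgroup.subset_closure (Set.mem_range_self 0)))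
  obtain ⟨b, hb⟩ := Subgroup.mem_zpowers_iff.1 (hsub (Subgroup.subset_closure (Set.mem_range_self 1)))
  rw [← ha, ← hb]
  exact zpow_mul_comm _ _ _

/-- **Two non-commuting elements of a free group form a free basis of the subgroup they
generate**: if `u₀ u₁ ≠ u₁ u₀` then `F(x₀, x₁) → F`, `xᵢ ↦ uᵢ`, is injective.
[cite: LyndonSchupp2001, Ch. I Prop. 2.5 and Prop. 2.7] -/
theorem lift_injective_of_mul_ne (u : Fin 2 → FreeGroup (Fin k)) (hu : u 0 * u 1 ≠ u 1 * u 0) :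
    Function.Injective (FreeGroup.lift u) := by
  obtain ⟨ε, hε⟩ := exists_forall_not_lt u
  have hne : ∀ i, (⇑(FreeGroup.lift u) ∘ basisImage ε) i ≠ 1 := by
    intro i hi
    rcases eq_or_ne i 0 with rfl | h0
    · exact hu (mul_eq_mul_of_transform_eq_one u ε 0 1 (by decide) hi)
    · have h1 : i = 1 := by
        have key : ∀ i : Fin 2, i ≠ 0 → i = 1 := by decide
        exact key i h0
      subst h1
      exact hu (mul_eq_mul_of_transform_eq_one u ε 1 0 (by decide) hi)
  have hinj := (isNielsenReduced_of_min_of_forall_ne_one _ hε hne).lift_injective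
  rw [lift_lift_comp_basisImage] at hinj
  intro x y hxy
  have := hinj (a₁ := ε.symm x) (a₂ := ε.symm y) (by
    simp only [MonoidHom.comp_apply, MulEquiv.coe_toMonoidHom, MulEquiv.apply_symm_apply]
    exact hxy)
  simpa using this

end Fin

/-- **Two non-commuting elements `x, y` of `F₂ = F⟨p, q⟩` freely generate `⟨x, y⟩`**: the
endomorphism `p ↦ x`, `q ↦ y` of `FreeGroup Bool` is injective.
[cite: LyndonSchupp2001, Ch. I Prop. 2.5 and Prop. 2.7] -/
theorem FreeGroup.lift_bool_injective_of_mul_ne (x y : FreeGroup Bool) (h : x * y ≠ y * x) :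
    Function.Injective (FreeGroup.lift fun b : Bool => cond b x y) := by
  let θ : FreeGroup Bool ≃* FreeGroup (Fin 2) := FreeGroup.freeGroupCongr finTwoEquiv.symm
  let u : Fin 2 → FreeGroup (Fin 2) := fun i => θ (cond (finTwoEquiv i) x y)
  have e0 : finTwoEquiv 0 = false := by decide
  have e1 : finTwoEquiv 1 = true := by decide
  have h0 : u 0 = θ y := by simp only [u, e0, cond_false]
  have h1 : u 1 = θ x := by simp only [u, e1, cond_true]
  have hu : u 0 * u 1 ≠ u 1 * u 0 := by
    rw [h0, h1, ← map_mul, ← map_mul]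
    exact fun h' => h (θ.injective h'.symm)
  have hrel : θ.toMonoidHom.comp (FreeGroup.lift fun b : Bool => cond b x y) =
      (FreeGroup.lift u).comp θ.toMonoidHom := by
    refine FreeGroup.ext_hom _ _ fun b => ?_
    have hθ : θ (FreeGroup.of b) = FreeGroup.of (finTwoEquiv.symm b) := FreeGroup.map.of
    simp only [MonoidHom.comp_apply, MulEquiv.coe_toMonoidHom, FreeGroup.lift_apply_of, hθ, u,
      Equiv.apply_symm_apply]
  intro a b hab
  have ha := DFunLike.congr_fun hrel a
  have hb := DFunLike.congr_fun hrel b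
  simp only [MonoidHom.comp_apply, MulEquiv.coe_toMonoidHom] at ha hb
  have := lift_injective_of_mul_ne u hu (a₁ := θ a) (a₂ := θ b) (by rw [← ha, ← hb, hab])
  exact θ.injective this

end Literature.GroupTheory.CombinatorialGroupTheory
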